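import Mathlib
import HarnessLib
import Summits.ValiantsHypothesis.ValiantsHypothesis.Theorems.LacunarySymmetroidMatrixDescartesOsculationCensusRectangle
import Summits.ValiantsHypothesis.ValiantsHypothesis.Theorems.LacunarySymmetroidMatrixDescartesOsculationLawCuspCubicNonMonicAlgebra

/-!
# ValiantsHypothesis / LacunarySymmetroid — crux `MatrixDescartes` (stmt-ValiantsHypothesis-18050, V1),
# line «osculation-law», rung O3: the rank-three LOWER certificate in the RECTANGLE currency, every splitting `(3, s)` — from values only

Roster R2664 (b) / R2685 (O3 = val-sym-engine-7; this file engine-7 g6).  Companion of ✓ `…OsculationCensusRankThreeSCert` /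
✓ `…RankThreeSLower` (`osc_rankThreeS_card_ge`, which needs `L₁·L₀ < 0`, `R₂ ≠ 0` on every window, i.e. the EXPANDED eliminants of
degrees `35n`, `88n`).  Here the window hypotheses involve ONLY the four coefficient polynomials `a₃, a₂, a₁, a₀` of the non-monic cubic letter
(`Φ = a₃b³ + a₂b² + a₁b + a₀`, ✓ `OsculationCuspCubic.eval_Psi3`) and their first two derivatives, on an interval or at the two end abscissae:
* `osc_rankThreeS_card_ge_rect`: a list of pairwise `t`-separated RECTANGLES `(l, u, β₁, β₂)` (`0 < l ≤ u`, `0 < β₁ ≤ β₂`), each with signs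
  `τ, σ` and end sub-intervals `[βl₁, βl₂], [βu₁, βu₂] ⊆ [β₁, β₂]` (`βl₁ ≤ βl₂`, `βu₁ ≤ βu₂`) such that (i) `τΦ(t, β₁) < 0 < τΦ(t, β₂)` for `t ∈ [l, u]`, (ii)
  `τ·∂_bΦ > 0` on the rectangle, (iii) `τΦ(l, βl₁) < 0 < τΦ(l, βl₂)` and `σ·H(l, ·) > 0` on `[βl₁, βl₂]`, (iv) the same at `u` with `σ·H(u, ·) < 0`
  — `H` in values exactly as in ✓ `eval_logHessian_Psi3` — exhibits `W.length` distinct osculation points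
(the one-application two-sided form `osc_rankThreeS_two_sided_rect` is filed separately in `…RankThreeSRectTwoSided`) (✓ `exists_zero_on_implicit_branch`:
  the sheet through the rectangle is a continuous implicit root `b = φ(t)`, `H(t, φ t)` changes sign).
`shifted_term_lb` / `shifted_term_nonneg`: corner bounds for the monomials of a SHIFTED expansion `Σ cᵢⱼ (x−l)ⁱ (y−β₁)ʲ`
(how an instance signs `∂_bΦ` near two close sheets, where plain termwise bounds cancel).
In an instance (i) and (iii)/(iv) are sign conditions of univariate polynomials with VALUE coefficients (termwise bounds in `t` at fixed
rational `β`, resp. in `b` at fixed rational `t`), and (ii) follows from termwise bounds of `a₃, a₂, a₁` on `[l, u]` by the corner lemmas of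
`…OsculationCensusRectangle`.

HONEST FRAMING.  Calibration tooling for a line stub (`m ≤ 6` formats are covered by `rungAll`); the LAW `stub_osculationLaw`, the crux
`MatrixDescartes`, Conjecture B and `VP ≠ VNP` are OPEN / NOT proved; no summit statement is proved by this file.  No definitions, no named facts;
Mathlib + `…OsculationCensusRectangle` + ✓ `…OsculationLawCuspCubicNonMonicAlgebra` (`eval_Psi3`, `eval_logHessian_Psi3`).
-/

-- `Summit.ValiantsHypothesis.ValiantsHypothesis.…` is the tree's mandated single-conjunct layout (Sub = Summit).
set_option linter.dupNamespace false
-- the unfolded osculation set and the Hessian-in-values are deep terms (as in every landed O3 file).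
set_option maxRecDepth 100000

noncomputable section

namespace Summit.ValiantsHypothesis.ValiantsHypothesis.Theorems.LacunarySymmetroidMatrixDescartes

open Polynomial Matrix Finset
open scoped BigOperators

namespace OsculationCensus

-- the statement carries the osculation set twice and the Hessian-in-values twice.
set_option maxHeartbeats 1600000 in
/-- **Rank-three LOWER certificate in the rectangle currency, every splitting `(3, s)`** (see the module docstring). [folklore] -/
theorem osc_rankThreeS_card_ge_rect {K s : ℕ} (d : Fin K → ℕ) (S : Fin K → Matrix (Fin 3 ⊕ Fin s) (Fin 3 ⊕ Fin s) ℝ)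
    (a₃ a₂ a₁ a₀ : ℝ[X])
    (hΦ : (∑ l, (MvPolynomial.X (0 : Fin 2) : MvPolynomial (Fin 2) ℝ) ^ d l •
              (S l).map (MvPolynomial.C : ℝ →+* MvPolynomial (Fin 2) ℝ)
            + (MvPolynomial.X (1 : Fin 2) : MvPolynomial (Fin 2) ℝ) •
              (Matrix.fromBlocks 1 0 0 0 : Matrix (Fin 3 ⊕ Fin s) (Fin 3 ⊕ Fin s) ℝ).map
                (MvPolynomial.C : ℝ →+* MvPolynomial (Fin 2) ℝ)).det =
      (MvPolynomial.X 1 * MvPolynomial.X 1 * MvPolynomial.X 1 * Polynomial.aeval (MvPolynomial.X 0 : MvPolynomial (Fin 2) ℝ) a₃ + MvPolynomial.X 1 * MvPolynomial.X 1 * Polynomial.aeval (MvPolynomial.X 0 : MvPolynomial (Fin 2) ℝ) a₂ + MvPolynomial.X 1 * Polynomial.aeval (MvPolynomial.X 0 : MvPolynomial (Fin 2) ℝ) a₁ + Polynomial.aeval (MvPolynomial.X 0 : MvPolynomial (Fin 2) ℝ) a₀))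
    (hfin : {p : Fin 2 → ℝ | 0 < p 0 ∧ 0 < p 1 ∧ MvPolynomial.eval p (∑ l, (MvPolynomial.X (0 : Fin 2) : MvPolynomial (Fin 2) ℝ) ^ d l • (S l).map (MvPolynomial.C : ℝ →+* MvPolynomial (Fin 2) ℝ) +
      (MvPolynomial.X (1 : Fin 2) : MvPolynomial (Fin 2) ℝ) • (Matrix.fromBlocks 1 0 0 0 : Matrix (Fin 3 ⊕ Fin s) (Fin 3 ⊕ Fin s) ℝ).map (MvPolynomial.C : ℝ →+* MvPolynomial (Fin 2) ℝ)).det = 0 ∧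
      MvPolynomial.eval p (MvPolynomial.X 0 * MvPolynomial.pderiv 0 (MvPolynomial.X 0 * MvPolynomial.pderiv 0 (∑ l, (MvPolynomial.X (0 : Fin 2) : MvPolynomial (Fin 2) ℝ) ^ d l • (S l).map
      (MvPolynomial.C : ℝ →+* MvPolynomial (Fin 2) ℝ) + (MvPolynomial.X (1 : Fin 2) : MvPolynomial (Fin 2) ℝ) • (Matrix.fromBlocks 1 0 0 0 : Matrix (Fin 3 ⊕ Fin s) (Fin 3 ⊕ Fin s) ℝ).map
      (MvPolynomial.C : ℝ →+* MvPolynomial (Fin 2) ℝ)).det) * (MvPolynomial.X 1 * MvPolynomial.pderiv 1 (∑ l, (MvPolynomial.X (0 : Fin 2) : MvPolynomial (Fin 2) ℝ) ^ d l • (S l).map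
      (MvPolynomial.C : ℝ →+* MvPolynomial (Fin 2) ℝ) + (MvPolynomial.X (1 : Fin 2) : MvPolynomial (Fin 2) ℝ) • (Matrix.fromBlocks 1 0 0 0 : Matrix (Fin 3 ⊕ Fin s) (Fin 3 ⊕ Fin s) ℝ).map
      (MvPolynomial.C : ℝ →+* MvPolynomial (Fin 2) ℝ)).det) ^ 2 - 2 * (MvPolynomial.X 0 * MvPolynomial.pderiv 0 (MvPolynomial.X 1 * MvPolynomial.pderiv 1 (∑ l, (MvPolynomial.X (0 : Fin 2) :
      MvPolynomial (Fin 2) ℝ) ^ d l • (S l).map (MvPolynomial.C : ℝ →+* MvPolynomial (Fin 2) ℝ) + (MvPolynomial.X (1 : Fin 2) : MvPolynomial (Fin 2) ℝ) • (Matrix.fromBlocks 1 0 0 0 : Matrix (Fin 3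
      ⊕ Fin s) (Fin 3 ⊕ Fin s) ℝ).map (MvPolynomial.C : ℝ →+* MvPolynomial (Fin 2) ℝ)).det)) * (MvPolynomial.X 0 * MvPolynomial.pderiv 0 (∑ l, (MvPolynomial.X (0 : Fin 2) : MvPolynomial (Fin 2) ℝ)
      ^ d l • (S l).map (MvPolynomial.C : ℝ →+* MvPolynomial (Fin 2) ℝ) + (MvPolynomial.X (1 : Fin 2) : MvPolynomial (Fin 2) ℝ) • (Matrix.fromBlocks 1 0 0 0 : Matrix (Fin 3 ⊕ Fin s) (Fin 3 ⊕ Fin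
      s) ℝ).map (MvPolynomial.C : ℝ →+* MvPolynomial (Fin 2) ℝ)).det) * (MvPolynomial.X 1 * MvPolynomial.pderiv 1 (∑ l, (MvPolynomial.X (0 : Fin 2) : MvPolynomial (Fin 2) ℝ) ^ d l • (S l).map
      (MvPolynomial.C : ℝ →+* MvPolynomial (Fin 2) ℝ) + (MvPolynomial.X (1 : Fin 2) : MvPolynomial (Fin 2) ℝ) • (Matrix.fromBlocks 1 0 0 0 : Matrix (Fin 3 ⊕ Fin s) (Fin 3 ⊕ Fin s) ℝ).map
      (MvPolynomial.C : ℝ →+* MvPolynomial (Fin 2) ℝ)).det) + MvPolynomial.X 1 * MvPolynomial.pderiv 1 (MvPolynomial.X 1 * MvPolynomial.pderiv 1 (∑ l, (MvPolynomial.X (0 : Fin 2) : MvPolynomial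
      (Fin 2) ℝ) ^ d l • (S l).map (MvPolynomial.C : ℝ →+* MvPolynomial (Fin 2) ℝ) + (MvPolynomial.X (1 : Fin 2) : MvPolynomial (Fin 2) ℝ) • (Matrix.fromBlocks 1 0 0 0 : Matrix (Fin 3 ⊕ Fin s)
      (Fin 3 ⊕ Fin s) ℝ).map (MvPolynomial.C : ℝ →+* MvPolynomial (Fin 2) ℝ)).det) * (MvPolynomial.X 0 * MvPolynomial.pderiv 0 (∑ l, (MvPolynomial.X (0 : Fin 2) : MvPolynomial (Fin 2) ℝ) ^ d l •
      (S l).map (MvPolynomial.C : ℝ →+* MvPolynomial (Fin 2) ℝ) + (MvPolynomial.X (1 : Fin 2) : MvPolynomial (Fin 2) ℝ) • (Matrix.fromBlocks 1 0 0 0 : Matrix (Fin 3 ⊕ Fin s) (Fin 3 ⊕ Fin s) ℝ).map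
      (MvPolynomial.C : ℝ →+* MvPolynomial (Fin 2) ℝ)).det) ^ 2) = 0}.Finite)
    (W : List (ℝ × ℝ × ℝ × ℝ)) (hsep : W.Pairwise (fun v w => v.2.1 < w.1))
    (hW : ∀ w ∈ W, 0 < w.1 ∧ w.1 ≤ w.2.1 ∧ 0 < w.2.2.1 ∧ w.2.2.1 ≤ w.2.2.2 ∧
      ∃ τ σ βl₁ βl₂ βu₁ βu₂ : ℝ,
        (∀ x, w.1 ≤ x → x ≤ w.2.1 → τ * (a₃.eval x * w.2.2.1 ^ 3 + a₂.eval x * w.2.2.1 ^ 2 + a₁.eval x * w.2.2.1 + a₀.eval x) < 0 ∧ 0 < τ * (a₃.eval x * w.2.2.2 ^ 3 + a₂.eval x * w.2.2.2 ^ 2 + a₁.eval x * w.2.2.2 + a₀.eval x)) ∧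
        (∀ x y, w.1 ≤ x → x ≤ w.2.1 → w.2.2.1 ≤ y → y ≤ w.2.2.2 → 0 < τ * (3 * a₃.eval x * y ^ 2 + 2 * a₂.eval x * y + a₁.eval x)) ∧
        (w.2.2.1 ≤ βl₁ ∧ βl₁ ≤ βl₂ ∧ βl₂ ≤ w.2.2.2 ∧ τ * (a₃.eval w.1 * βl₁ ^ 3 + a₂.eval w.1 * βl₁ ^ 2 + a₁.eval w.1 * βl₁ + a₀.eval w.1) < 0 ∧ 0 < τ * (a₃.eval w.1 * βl₂ ^ 3 + a₂.eval w.1 * βl₂ ^ 2 + a₁.eval w.1 * βl₂ + a₀.eval w.1) ∧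
          ∀ y, βl₁ ≤ y → y ≤ βl₂ → 0 < σ * (((w.1 * (derivative a₃).eval w.1 + w.1 ^ 2 * (derivative (derivative a₃)).eval w.1) * y ^ 3 + (w.1 * (derivative a₂).eval w.1 + w.1 ^ 2 * (derivative (derivative a₂)).eval w.1) * y ^ 2
          + (w.1 * (derivative a₁).eval w.1 + w.1 ^ 2 * (derivative (derivative a₁)).eval w.1) * y + (w.1 * (derivative a₀).eval w.1
          + w.1 ^ 2 * (derivative (derivative a₀)).eval w.1)) * (3 * a₃.eval w.1 * y ^ 3 + 2 * a₂.eval w.1 * y ^ 2 + a₁.eval w.1 * y) ^ 2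
          - 2 * (3 * (w.1 * (derivative a₃).eval w.1) * y ^ 3 + 2 * (w.1 * (derivative a₂).eval w.1) * y ^ 2 + (w.1 * (derivative a₁).eval w.1) * y) * ((w.1 * (derivative a₃).eval w.1) * y ^ 3
          + (w.1 * (derivative a₂).eval w.1) * y ^ 2 + (w.1 * (derivative a₁).eval w.1) * y + (w.1 * (derivative a₀).eval w.1)) * (3 * a₃.eval w.1 * y ^ 3
          + 2 * a₂.eval w.1 * y ^ 2 + a₁.eval w.1 * y) + (9 * a₃.eval w.1 * y ^ 3 + 4 * a₂.eval w.1 * y ^ 2 + a₁.eval w.1 * y) * ((w.1 * (derivative a₃).eval w.1) * y ^ 3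
          + (w.1 * (derivative a₂).eval w.1) * y ^ 2 + (w.1 * (derivative a₁).eval w.1) * y + (w.1 * (derivative a₀).eval w.1)) ^ 2)) ∧
        (w.2.2.1 ≤ βu₁ ∧ βu₁ ≤ βu₂ ∧ βu₂ ≤ w.2.2.2 ∧ τ * (a₃.eval w.2.1 * βu₁ ^ 3 + a₂.eval w.2.1 * βu₁ ^ 2 + a₁.eval w.2.1 * βu₁ + a₀.eval w.2.1) < 0 ∧ 0 < τ * (a₃.eval w.2.1 * βu₂ ^ 3 + a₂.eval w.2.1 * βu₂ ^ 2 + a₁.eval w.2.1 * βu₂ + a₀.eval w.2.1) ∧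
          ∀ y, βu₁ ≤ y → y ≤ βu₂ → σ * (((w.2.1 * (derivative a₃).eval w.2.1 + w.2.1 ^ 2 * (derivative (derivative a₃)).eval w.2.1) * y ^ 3 + (w.2.1 * (derivative a₂).eval w.2.1 + w.2.1 ^ 2 * (derivative (derivative a₂)).eval w.2.1) * y ^ 2
          + (w.2.1 * (derivative a₁).eval w.2.1 + w.2.1 ^ 2 * (derivative (derivative a₁)).eval w.2.1) * y + (w.2.1 * (derivative a₀).eval w.2.1
          + w.2.1 ^ 2 * (derivative (derivative a₀)).eval w.2.1)) * (3 * a₃.eval w.2.1 * y ^ 3 + 2 * a₂.eval w.2.1 * y ^ 2 + a₁.eval w.2.1 * y) ^ 2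
          - 2 * (3 * (w.2.1 * (derivative a₃).eval w.2.1) * y ^ 3 + 2 * (w.2.1 * (derivative a₂).eval w.2.1) * y ^ 2 + (w.2.1 * (derivative a₁).eval w.2.1) * y) * ((w.2.1 * (derivative a₃).eval w.2.1) * y ^ 3
          + (w.2.1 * (derivative a₂).eval w.2.1) * y ^ 2 + (w.2.1 * (derivative a₁).eval w.2.1) * y + (w.2.1 * (derivative a₀).eval w.2.1)) * (3 * a₃.eval w.2.1 * y ^ 3
          + 2 * a₂.eval w.2.1 * y ^ 2 + a₁.eval w.2.1 * y) + (9 * a₃.eval w.2.1 * y ^ 3 + 4 * a₂.eval w.2.1 * y ^ 2 + a₁.eval w.2.1 * y) * ((w.2.1 * (derivative a₃).eval w.2.1) * y ^ 3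
          + (w.2.1 * (derivative a₂).eval w.2.1) * y ^ 2 + (w.2.1 * (derivative a₁).eval w.2.1) * y + (w.2.1 * (derivative a₀).eval w.2.1)) ^ 2) < 0)) :
    W.length ≤ {p : Fin 2 → ℝ | 0 < p 0 ∧ 0 < p 1 ∧ MvPolynomial.eval p (∑ l, (MvPolynomial.X (0 : Fin 2) : MvPolynomial (Fin 2) ℝ) ^ d l • (S l).map (MvPolynomial.C : ℝ →+* MvPolynomial (Fin 2) ℝ) +
      (MvPolynomial.X (1 : Fin 2) : MvPolynomial (Fin 2) ℝ) • (Matrix.fromBlocks 1 0 0 0 : Matrix (Fin 3 ⊕ Fin s) (Fin 3 ⊕ Fin s) ℝ).map (MvPolynomial.C : ℝ →+* MvPolynomial (Fin 2) ℝ)).det = 0 ∧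
      MvPolynomial.eval p (MvPolynomial.X 0 * MvPolynomial.pderiv 0 (MvPolynomial.X 0 * MvPolynomial.pderiv 0 (∑ l, (MvPolynomial.X (0 : Fin 2) : MvPolynomial (Fin 2) ℝ) ^ d l • (S l).map
      (MvPolynomial.C : ℝ →+* MvPolynomial (Fin 2) ℝ) + (MvPolynomial.X (1 : Fin 2) : MvPolynomial (Fin 2) ℝ) • (Matrix.fromBlocks 1 0 0 0 : Matrix (Fin 3 ⊕ Fin s) (Fin 3 ⊕ Fin s) ℝ).map
      (MvPolynomial.C : ℝ →+* MvPolynomial (Fin 2) ℝ)).det) * (MvPolynomial.X 1 * MvPolynomial.pderiv 1 (∑ l, (MvPolynomial.X (0 : Fin 2) : MvPolynomial (Fin 2) ℝ) ^ d l • (S l).map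
      (MvPolynomial.C : ℝ →+* MvPolynomial (Fin 2) ℝ) + (MvPolynomial.X (1 : Fin 2) : MvPolynomial (Fin 2) ℝ) • (Matrix.fromBlocks 1 0 0 0 : Matrix (Fin 3 ⊕ Fin s) (Fin 3 ⊕ Fin s) ℝ).map
      (MvPolynomial.C : ℝ →+* MvPolynomial (Fin 2) ℝ)).det) ^ 2 - 2 * (MvPolynomial.X 0 * MvPolynomial.pderiv 0 (MvPolynomial.X 1 * MvPolynomial.pderiv 1 (∑ l, (MvPolynomial.X (0 : Fin 2) :
      MvPolynomial (Fin 2) ℝ) ^ d l • (S l).map (MvPolynomial.C : ℝ →+* MvPolynomial (Fin 2) ℝ) + (MvPolynomial.X (1 : Fin 2) : MvPolynomial (Fin 2) ℝ) • (Matrix.fromBlocks 1 0 0 0 : Matrix (Fin 3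
      ⊕ Fin s) (Fin 3 ⊕ Fin s) ℝ).map (MvPolynomial.C : ℝ →+* MvPolynomial (Fin 2) ℝ)).det)) * (MvPolynomial.X 0 * MvPolynomial.pderiv 0 (∑ l, (MvPolynomial.X (0 : Fin 2) : MvPolynomial (Fin 2) ℝ)
      ^ d l • (S l).map (MvPolynomial.C : ℝ →+* MvPolynomial (Fin 2) ℝ) + (MvPolynomial.X (1 : Fin 2) : MvPolynomial (Fin 2) ℝ) • (Matrix.fromBlocks 1 0 0 0 : Matrix (Fin 3 ⊕ Fin s) (Fin 3 ⊕ Fin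
      s) ℝ).map (MvPolynomial.C : ℝ →+* MvPolynomial (Fin 2) ℝ)).det) * (MvPolynomial.X 1 * MvPolynomial.pderiv 1 (∑ l, (MvPolynomial.X (0 : Fin 2) : MvPolynomial (Fin 2) ℝ) ^ d l • (S l).map
      (MvPolynomial.C : ℝ →+* MvPolynomial (Fin 2) ℝ) + (MvPolynomial.X (1 : Fin 2) : MvPolynomial (Fin 2) ℝ) • (Matrix.fromBlocks 1 0 0 0 : Matrix (Fin 3 ⊕ Fin s) (Fin 3 ⊕ Fin s) ℝ).map
      (MvPolynomial.C : ℝ →+* MvPolynomial (Fin 2) ℝ)).det) + MvPolynomial.X 1 * MvPolynomial.pderiv 1 (MvPolynomial.X 1 * MvPolynomial.pderiv 1 (∑ l, (MvPolynomial.X (0 : Fin 2) : MvPolynomial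
      (Fin 2) ℝ) ^ d l • (S l).map (MvPolynomial.C : ℝ →+* MvPolynomial (Fin 2) ℝ) + (MvPolynomial.X (1 : Fin 2) : MvPolynomial (Fin 2) ℝ) • (Matrix.fromBlocks 1 0 0 0 : Matrix (Fin 3 ⊕ Fin s)
      (Fin 3 ⊕ Fin s) ℝ).map (MvPolynomial.C : ℝ →+* MvPolynomial (Fin 2) ℝ)).det) * (MvPolynomial.X 0 * MvPolynomial.pderiv 0 (∑ l, (MvPolynomial.X (0 : Fin 2) : MvPolynomial (Fin 2) ℝ) ^ d l •
      (S l).map (MvPolynomial.C : ℝ →+* MvPolynomial (Fin 2) ℝ) + (MvPolynomial.X (1 : Fin 2) : MvPolynomial (Fin 2) ℝ) • (Matrix.fromBlocks 1 0 0 0 : Matrix (Fin 3 ⊕ Fin s) (Fin 3 ⊕ Fin s) ℝ).map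
      (MvPolynomial.C : ℝ →+* MvPolynomial (Fin 2) ℝ)).det) ^ 2) = 0}.ncard := by
  classical
  rw [hΦ] at hfin ⊢
  set Φ : MvPolynomial (Fin 2) ℝ := (MvPolynomial.X 1 * MvPolynomial.X 1 * MvPolynomial.X 1 * Polynomial.aeval (MvPolynomial.X 0 : MvPolynomial (Fin 2) ℝ) a₃ + MvPolynomial.X 1 * MvPolynomial.X 1 * Polynomial.aeval (MvPolynomial.X 0 : MvPolynomial (Fin 2) ℝ) a₂ + MvPolynomial.X 1 * Polynomial.aeval (MvPolynomial.X 0 : MvPolynomial (Fin 2) ℝ) a₁ + Polynomial.aeval (MvPolynomial.X 0 : MvPolynomial (Fin 2) ℝ) a₀) with hΦdef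
  set osc := {p : Fin 2 → ℝ | 0 < p 0 ∧ 0 < p 1 ∧ MvPolynomial.eval p Φ = 0 ∧
      MvPolynomial.eval p
        (MvPolynomial.X 0 * MvPolynomial.pderiv 0 (MvPolynomial.X 0 * MvPolynomial.pderiv 0 Φ)
            * (MvPolynomial.X 1 * MvPolynomial.pderiv 1 Φ) ^ 2
          - 2 * (MvPolynomial.X 0 * MvPolynomial.pderiv 0 (MvPolynomial.X 1 * MvPolynomial.pderiv 1 Φ))
            * (MvPolynomial.X 0 * MvPolynomial.pderiv 0 Φ) * (MvPolynomial.X 1 * MvPolynomial.pderiv 1 Φ)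
          + MvPolynomial.X 1 * MvPolynomial.pderiv 1 (MvPolynomial.X 1 * MvPolynomial.pderiv 1 Φ)
            * (MvPolynomial.X 0 * MvPolynomial.pderiv 0 Φ) ^ 2) = 0} with hosc
  -- the cubic and the Hessian in values, as functions of `(t, b)`
  let F : ℝ → ℝ → ℝ := fun t b => (a₃.eval t * b ^ 3 + a₂.eval t * b ^ 2 + a₁.eval t * b + a₀.eval t)
  let G : ℝ → ℝ → ℝ := fun t b => ((t * (derivative a₃).eval t + t ^ 2 * (derivative (derivative a₃)).eval t) * b ^ 3 + (t * (derivative a₂).eval t + t ^ 2 * (derivative (derivative a₂)).eval t) * b ^ 2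
          + (t * (derivative a₁).eval t + t ^ 2 * (derivative (derivative a₁)).eval t) * b + (t * (derivative a₀).eval t
          + t ^ 2 * (derivative (derivative a₀)).eval t)) * (3 * a₃.eval t * b ^ 3 + 2 * a₂.eval t * b ^ 2 + a₁.eval t * b) ^ 2
          - 2 * (3 * (t * (derivative a₃).eval t) * b ^ 3 + 2 * (t * (derivative a₂).eval t) * b ^ 2 + (t * (derivative a₁).eval t) * b) * ((t * (derivative a₃).eval t) * b ^ 3
          + (t * (derivative a₂).eval t) * b ^ 2 + (t * (derivative a₁).eval t) * b + (t * (derivative a₀).eval t)) * (3 * a₃.eval t * b ^ 3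
          + 2 * a₂.eval t * b ^ 2 + a₁.eval t * b) + (9 * a₃.eval t * b ^ 3 + 4 * a₂.eval t * b ^ 2 + a₁.eval t * b) * ((t * (derivative a₃).eval t) * b ^ 3
          + (t * (derivative a₂).eval t) * b ^ 2 + (t * (derivative a₁).eval t) * b + (t * (derivative a₀).eval t)) ^ 2
  have mem_of : ∀ t b : ℝ, 0 < t → 0 < b → F t b = 0 → G t b = 0 → (![t, b] : Fin 2 → ℝ) ∈ osc := by
    intro t b ht hb hF0 hG0
    refine ⟨by simpa using ht, by simpa using hb, ?_, ?_⟩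
    · rw [hΦdef, OsculationCuspCubic.eval_Psi3]
      simpa using hF0
    · rw [OsculationCuspCubic.eval_logHessian_Psi3 a₃ a₂ a₁ a₀ Φ hΦdef]
      simpa using hG0
  have hFc : Continuous (fun p : ℝ × ℝ => F p.1 p.2) := by
    simp only [F]
    fun_prop
  have hGc : Continuous (fun p : ℝ × ℝ => G p.1 p.2) := by
    simp only [G]
    fun_prop
  -- strict monotonicity of `τ·F(t,·)` from the sign of `τ·∂_bF`
  have hmonoF : ∀ (τ t β₁ β₂ : ℝ), (∀ y, β₁ ≤ y → y ≤ β₂ → 0 < τ * (3 * a₃.eval t * y ^ 2 + 2 * a₂.eval t * y + a₁.eval t)) →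
      StrictMonoOn (fun b => τ * F t b) (Set.Icc β₁ β₂) := by
    intro τ t β₁ β₂ hpos
    refine strictMonoOn_of_deriv_pos (convex_Icc β₁ β₂) (by simp only [F]; fun_prop) ?_
    intro x hx
    rw [interior_Icc] at hx
    have h := (((((hasDerivAt_pow 3 x).const_mul (a₃.eval t)).add ((hasDerivAt_pow 2 x).const_mul (a₂.eval t))).add
      ((hasDerivAt_id' x).const_mul (a₁.eval t))).add_const (a₀.eval t)).const_mul τ
    have h' : HasDerivAt (fun b => τ * F t b) (τ * (3 * a₃.eval t * x ^ 2 + 2 * a₂.eval t * x + a₁.eval t)) x :=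
      h.congr_deriv (by push_cast; ring)
    rw [h'.deriv]
    exact hpos x hx.1.le hx.2.le
  -- index the windows
  set k := W.length with hk
  set lo : Fin k → ℝ := fun i => (W.get i).1 with hlo
  set up : Fin k → ℝ := fun i => (W.get i).2.1 with hup
  have hsep' : ∀ i j : Fin k, i < j → up i < lo j := by
    intro i j hij
    have := List.pairwise_iff_get.1 hsep i j hij
    simpa [hlo, hup] using this
  -- one osculation point per rectangle
  have hpt : ∀ i : Fin k, ∃ t b : ℝ, lo i ≤ t ∧ t ≤ up i ∧ 0 < t ∧ 0 < b ∧ F t b = 0 ∧ G t b = 0 := by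
    intro i
    obtain ⟨hl0, hlu, hb0, hbb, τ, σ, βl₁, βl₂, βu₁, βu₂, hedge, hder, ⟨hl1, hl12, hl2, hFl1, hFl2, hGl⟩, ⟨hu1, hu12, hu2, hFu1, hFu2, hGu⟩⟩ :=
      hW (W.get i) (List.get_mem W i)
    set l := (W.get i).1
    set u := (W.get i).2.1
    set β₁ := (W.get i).2.2.1
    set β₂ := (W.get i).2.2.2
    have hmono : ∀ t ∈ Set.Icc l u, StrictMonoOn (fun b => τ * F t b) (Set.Icc β₁ β₂) := fun t ht =>
      hmonoF τ t β₁ β₂ (fun y h1 h2 => hder t y ht.1 ht.2 h1 h2)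
    -- end-point signs of `σ·G` at the fibre root, from the sub-intervals
    have hroot_l : ∀ b ∈ Set.Icc β₁ β₂, τ * F l b = 0 → 0 < σ * G l b := by
      intro b hb hb0
      have hm := (hmono l ⟨le_rfl, hlu⟩).monotoneOn
      have hm1 : βl₁ ∈ Set.Icc β₁ β₂ := ⟨hl1, hl12.trans hl2⟩
      have hm2 : βl₂ ∈ Set.Icc β₁ β₂ := ⟨hl1.trans hl12, hl2⟩
      have h1 : βl₁ < b := by
        by_contra hle
        push Not at hle
        have h := hm hb hm1 hle
        simp only at h
        linarith
      have h2 : b < βl₂ := by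
        by_contra hle
        push Not at hle
        have h := hm hm2 hb hle
        simp only at h
        linarith
      exact hGl b h1.le h2.le
    have hroot_u : ∀ b ∈ Set.Icc β₁ β₂, τ * F u b = 0 → σ * G u b < 0 := by
      intro b hb hb0
      have hm := (hmono u ⟨hlu, le_rfl⟩).monotoneOn
      have hm1 : βu₁ ∈ Set.Icc β₁ β₂ := ⟨hu1, hu12.trans hu2⟩
      have hm2 : βu₂ ∈ Set.Icc β₁ β₂ := ⟨hu1.trans hu12, hu2⟩
      have h1 : βu₁ < b := by
        by_contra hle
        push Not at hle
        have h := hm hb hm1 hle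
        simp only at h
        linarith
      have h2 : b < βu₂ := by
        by_contra hle
        push Not at hle
        have h := hm hm2 hb hle
        simp only at h
        linarith
      exact hGu b h1.le h2.le
    obtain ⟨t, ht, b, hb, hFt, hGt⟩ := exists_zero_on_implicit_branch (fun t b => τ * F t b) G l u β₁ β₂ σ hlu hbb
      ((continuous_const.mul hFc).continuousOn) hGc.continuousOn hmono
      (fun t ht => (hedge t ht.1 ht.2).1) (fun t ht => (hedge t ht.1 ht.2).2) hroot_l hroot_u
    have hτ : τ ≠ 0 := by
      rintro rfl
      have := (hedge l le_rfl hlu).1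
      simp at this
    refine ⟨t, b, ht.1, ht.2, lt_of_lt_of_le hl0 ht.1, lt_of_lt_of_le hb0 hb.1, ?_, hGt⟩
    simpa [hτ] using hFt
  choose t b htb using hpt
  set pt : Fin k → (Fin 2 → ℝ) := fun i => ![t i, b i] with hptdef
  have hmem : ∀ i, pt i ∈ osc := fun i =>
    mem_of (t i) (b i) (htb i).2.2.1 (htb i).2.2.2.1 (htb i).2.2.2.2.1 (htb i).2.2.2.2.2
  have hinj : Function.Injective pt := by
    intro i j hij
    have h0 : t i = t j := by
      have := congr_fun hij 0
      simpa [hptdef] using this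
    by_contra hne
    rcases lt_or_gt_of_ne hne with h | h
    · have := hsep' i j h
      linarith [(htb i).2.1, (htb j).1]
    · have := hsep' j i h
      linarith [(htb j).2.1, (htb i).1]
  have hsub : ↑(Finset.univ.image pt) ⊆ osc := by
    intro p hp
    rw [Finset.mem_coe, Finset.mem_image] at hp
    obtain ⟨i, -, rfl⟩ := hp
    exact hmem i
  calc k = (Finset.univ.image pt).card := by rw [Finset.card_image_of_injective _ hinj, Finset.card_univ, Fintype.card_fin]
    _ = (↑(Finset.univ.image pt) : Set (Fin 2 → ℝ)).ncard := (Set.ncard_coe_finset _).symm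
    _ ≤ osc.ncard := Set.ncard_le_ncard hsub hfin

/-! ### Shifted termwise bounds (instances sign `∂_bΦ` on a rectangle after the shift `x = l + s`, `y = β₁ + r`) -/

/-- A monomial of the shifted expansion with a nonpositive coefficient is bounded below by its value at the far corner:
`c ≤ 0`, `0 ≤ s ≤ S`, `0 ≤ r ≤ R` ⇒ `c·(Sⁱ·Rʲ) ≤ c·(sⁱ·rʲ)`. [folklore] -/
theorem shifted_term_lb {c s r S R : ℝ} (i j : ℕ) (hc : c ≤ 0) (hs0 : 0 ≤ s) (hs : s ≤ S) (hr0 : 0 ≤ r) (hr : r ≤ R) :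
    c * (S ^ i * R ^ j) ≤ c * (s ^ i * r ^ j) := by
  have h1 : s ^ i * r ^ j ≤ S ^ i * R ^ j :=
    mul_le_mul (pow_le_pow_left₀ hs0 hs i) (pow_le_pow_left₀ hr0 hr j) (pow_nonneg hr0 j) (pow_nonneg (hs0.trans hs) i)
  exact mul_le_mul_of_nonpos_left h1 hc

/-- … and with a nonnegative coefficient it is nonnegative. [folklore] -/
theorem shifted_term_nonneg {c s r : ℝ} (i j : ℕ) (hc : 0 ≤ c) (hs0 : 0 ≤ s) (hr0 : 0 ≤ r) : 0 ≤ c * (s ^ i * r ^ j) :=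
  mul_nonneg hc (mul_nonneg (pow_nonneg hs0 i) (pow_nonneg hr0 j))

/-- One-variable versions: `c ≤ 0`, `0 ≤ s ≤ S` ⇒ `c·Sⁱ ≤ c·sⁱ`; `0 ≤ c` ⇒ `0 ≤ c·sⁱ`. [folklore] -/
theorem shifted_term_lb1 {c s S : ℝ} (i : ℕ) (hc : c ≤ 0) (hs0 : 0 ≤ s) (hs : s ≤ S) : c * S ^ i ≤ c * s ^ i :=
  mul_le_mul_of_nonpos_left (pow_le_pow_left₀ hs0 hs i) hc

/-- `0 ≤ c`, `0 ≤ s` ⇒ `0 ≤ c·sⁱ`. [folklore] -/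
theorem shifted_term_nonneg1 {c s : ℝ} (i : ℕ) (hc : 0 ≤ c) (hs0 : 0 ≤ s) : 0 ≤ c * s ^ i :=
  mul_nonneg hc (pow_nonneg hs0 i)

/-- Upper versions: `0 ≤ c`, `0 ≤ s ≤ S` ⇒ `c·sⁱ ≤ c·Sⁱ`. [folklore] -/
theorem shifted_term_ub1 {c s S : ℝ} (i : ℕ) (hc : 0 ≤ c) (hs0 : 0 ≤ s) (hs : s ≤ S) : c * s ^ i ≤ c * S ^ i :=
  mul_le_mul_of_nonneg_left (pow_le_pow_left₀ hs0 hs i) hc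

/-- `c ≤ 0`, `0 ≤ s` ⇒ `c·sⁱ ≤ 0`. [folklore] -/
theorem shifted_term_nonpos1 {c s : ℝ} (i : ℕ) (hc : c ≤ 0) (hs0 : 0 ≤ s) : c * s ^ i ≤ 0 :=
  mul_nonpos_of_nonpos_of_nonneg hc (pow_nonneg hs0 i)

end OsculationCensus

end Summit.ValiantsHypothesis.ValiantsHypothesis.Theorems.LacunarySymmetroidMatrixDescartes
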